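import Mathlib
import Summits.CriticalPhenomena.Ising3DConformalLimit.Theorems.PrecisionLaplacianDirectCorrelationStableTailScaleRegularityAux4
import Summits.CriticalPhenomena.Ising3DConformalLimit.Theorems.PrecisionLaplacianDirectCorrelationStableTailScaleRegularityAux5

/-!
# The three regularity clauses from the three rates (helpers for stub `stub_scaleRegularity`)

For a lattice function `a : ℤ³ → ℝ`, nonnegative off the origin and sign-flip invariant, ASSUME the three
RATES of the scale-regularity stub of line `self-energy-pick-inversion` (crux stmt-CriticalPhenomena-4799)
for its slab profiles `a(insertNth i n ·)` (`n ≥ 2N₁ + 2`, resp. `2N₁ + 4`):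

* (R0) `|a(insertNth i n y)| n^{5-η} ≤ C₀`,
* (R1') `|a(insertNth i n y) − a(insertNth i n y')| n^{6-η} ≤ C₁ Σ_j |y_j − y'_j|`,
* (R2') `|a(insertNth i n y) − a(insertNth i (n+1) y)| n^{6-η} ≤ C₂`.

Then the three clauses of `IsRegularAtScale a η` follow: (R1) boundedness of `a(x)|x|₂^{5-η}` (frame of the
largest coordinate + a finite set), (R2) asymptotic equicontinuity at scale (transverse step + longitudinal
chain inside the frame of `x`, `equicont_arith`), (R3) slab tightness (shell counting, `tightness_arith`,
given the radial lower bound `c/2 ≤ S⁽ⁱ⁾(n) n^{3-η}`).  The rates themselves are derived from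
Haus + Gap + Rad in the stub file.  Pure theorem file, no definitions.
-/

noncomputable section

namespace Summit.CriticalPhenomena.Ising3DConformalLimit.Cruxes.DirectCorrelationStableTail.SelfEnergyPickInversion

open Real
open scoped BigOperators

/-! ### Two lattice-geometric facts used by (R2) -/

/-- Reverse triangle inequality for the Euclidean length on `ℤ³` (written with `Real.sqrt`). -/
theorem abs_euclid_sub_euclid_le (x y : Fin 3 → ℤ) :
    |Real.sqrt (∑ j, ((x j : ℝ)) ^ 2) - Real.sqrt (∑ j, ((y j : ℝ)) ^ 2)|
      ≤ Real.sqrt (∑ j, (((x - y) j : ℝ)) ^ 2) := by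
  have key : ∀ z : Fin 3 → ℤ, Real.sqrt (∑ j, ((z j : ℝ)) ^ 2)
      = ‖(WithLp.toLp 2 (fun j => (z j : ℝ)) : EuclideanSpace ℝ (Fin 3))‖ := by
    intro z
    rw [EuclideanSpace.norm_eq]
    simp [Real.norm_eq_abs, sq_abs]
  have hsub : (WithLp.toLp 2 (fun j => ((x - y) j : ℝ)) : EuclideanSpace ℝ (Fin 3))
      = WithLp.toLp 2 (fun j => (x j : ℝ)) - WithLp.toLp 2 (fun j => (y j : ℝ)) := by
    rw [← WithLp.toLp_sub]; congr 1; funext j; simp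
  rw [key, key, key, hsub]
  exact abs_norm_sub_norm_le _ _

/-- The slab indices of two nearby points are close: `| |x_i| − |y_i| | ≤ |x − y|₂` (as naturals cast to `ℝ`). -/
theorem abs_natAbs_sub_natAbs_le (x y : Fin 3 → ℤ) (i : Fin 3) :
    |((x i).natAbs : ℝ) - ((y i).natAbs : ℝ)| ≤ Real.sqrt (∑ j, (((x - y) j : ℝ)) ^ 2) := by
  rw [Nat.cast_natAbs, Nat.cast_natAbs, Int.cast_abs, Int.cast_abs]
  refine (abs_abs_sub_abs_le_abs_sub _ _).trans ?_
  have := abs_coord_le_euclid (x - y) i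
  rwa [cast_sub_apply] at this

/-! ### (R1) boundedness -/

/-- **(R1)** from the axial rate: `a(x)|x|₂^{5-η}` is bounded. -/
theorem regular_bounded {a : (Fin 3 → ℤ) → ℝ} {η : ℝ} {N₁ : ℕ} {C₀ : ℝ}
    (hpos : ∀ x : Fin 3 → ℤ, x ≠ 0 → 0 ≤ a x)
    (hflip : ∀ (j : Fin 3) (x : Fin 3 → ℤ), a (Function.update x j (-x j)) = a x)
    (hη0 : 0 < η) (hη1 : η < 1)
    (hR0 : ∀ (i : Fin 3) (n : ℕ), 2 * N₁ + 2 ≤ n → ∀ y : Fin 2 → ℤ,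
      |a (Fin.insertNth i (n : ℤ) y)| * (n : ℝ) ^ (5 - η) ≤ C₀) :
    ∃ C : ℝ, ∀ x : Fin 3 → ℤ, x ≠ 0 → a x * Real.sqrt (∑ j, ((x j : ℝ)) ^ 2) ^ (5 - η) ≤ C := by
  have hp'0 : (0 : ℝ) ≤ 5 - η := by linarith
  have hp'5 : 5 - η ≤ (5 : ℝ) := by linarith
  set N : ℕ := 2 * N₁ + 2 with hN
  set B₀ : ℝ := ∑ x ∈ Fintype.piFinset (fun _ : Fin 3 => Finset.Icc (-(N : ℤ)) N),
    |a x * Real.sqrt (∑ j, ((x j : ℝ)) ^ 2) ^ (5 - η)| with hB₀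
  refine ⟨max (16 * C₀) B₀, fun x hx => ?_⟩
  obtain ⟨i, hi⟩ := exists_dominant_coord x
  by_cases hsmall : (x i).natAbs ≤ N
  · refine le_trans ?_ (le_max_right _ _)
    refine le_trans (le_abs_self _) (Finset.single_le_sum
      (f := fun x : Fin 3 → ℤ => |a x * Real.sqrt (∑ j, ((x j : ℝ)) ^ 2) ^ (5 - η)|)
      (fun _ _ => abs_nonneg _) ?_)
    rw [Fintype.mem_piFinset]
    intro j
    rw [Finset.mem_Icc, ← abs_le]
    calc |x j| ≤ |x i| := hi j
      _ = ((x i).natAbs : ℤ) := Int.abs_eq_natAbs (x i)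
      _ ≤ N := by exact_mod_cast hsmall
  · push Not at hsmall
    refine le_trans ?_ (le_max_left _ _)
    have hn1 : 2 * N₁ + 2 ≤ (x i).natAbs := by omega
    have hax : a (Fin.insertNth i (((x i).natAbs : ℕ) : ℤ) (Fin.removeNth i x)) = a x :=
      slab_profile_natAbs hflip x i
    have hrate := hR0 i (x i).natAbs hn1 (Fin.removeNth i x)
    rw [hax, abs_of_nonneg (hpos x hx)] at hrate
    have hxi : ((x i).natAbs : ℝ) = |(x i : ℝ)| := by rw [Nat.cast_natAbs, Int.cast_abs]
    have hr : Real.sqrt (∑ j, ((x j : ℝ)) ^ 2) ≤ Real.sqrt 3 * ((x i).natAbs : ℝ) := by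
      rw [hxi]; exact euclid_le_sqrt_three_mul x i hi
    have hn0 : (0 : ℝ) < (x i).natAbs := by exact_mod_cast (show 0 < (x i).natAbs by omega)
    calc a x * Real.sqrt (∑ j, ((x j : ℝ)) ^ 2) ^ (5 - η)
        ≤ a x * (16 * ((x i).natAbs : ℝ) ^ (5 - η)) :=
          mul_le_mul_of_nonneg_left (rpow_le_16_mul (Real.sqrt_nonneg _) hn0.le hr hp'0 hp'5)
            (hpos x hx)
      _ = 16 * (a x * ((x i).natAbs : ℝ) ^ (5 - η)) := by ring
      _ ≤ 16 * C₀ := by gcongr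

/-! ### (R2) asymptotic equicontinuity at scale -/

/-- **(R2)** from the three rates: asymptotic equicontinuity of `a(x)|x|₂^{5-η}` at its own scale. -/
theorem regular_equicontinuous {a : (Fin 3 → ℤ) → ℝ} {η : ℝ} {N₁ : ℕ} {C₀ C₁ C₂ : ℝ}
    (hflip : ∀ (j : Fin 3) (x : Fin 3 → ℤ), a (Function.update x j (-x j)) = a x)
    (hη0 : 0 < η) (hη1 : η < 1) (hC₀0 : 0 ≤ C₀) (hC₁0 : 0 ≤ C₁) (hC₂0 : 0 ≤ C₂)
    (hnn : ∀ (i : Fin 3) (n : ℕ), 1 ≤ n → ∀ y : Fin 2 → ℤ, 0 ≤ a (Fin.insertNth i (n : ℤ) y))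
    (hR0 : ∀ (i : Fin 3) (n : ℕ), 2 * N₁ + 2 ≤ n → ∀ y : Fin 2 → ℤ,
      |a (Fin.insertNth i (n : ℤ) y)| * (n : ℝ) ^ (5 - η) ≤ C₀)
    (hR1 : ∀ (i : Fin 3) (n : ℕ), 2 * N₁ + 2 ≤ n → ∀ y y' : Fin 2 → ℤ,
      |a (Fin.insertNth i (n : ℤ) y) - a (Fin.insertNth i (n : ℤ) y')| * (n : ℝ) ^ (6 - η)
        ≤ C₁ * ∑ j, |(y j : ℝ) - y' j|)
    (hR2 : ∀ (i : Fin 3) (n : ℕ), 2 * N₁ + 4 ≤ n → ∀ y : Fin 2 → ℤ,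
      |a (Fin.insertNth i (n : ℤ) y) - a (Fin.insertNth i ((n + 1 : ℕ) : ℤ) y)| * (n : ℝ) ^ (6 - η)
        ≤ C₂) :
    ∀ ε : ℝ, 0 < ε → ∃ δ : ℝ, 0 < δ ∧ ∃ R₀ : ℝ, ∀ x y : Fin 3 → ℤ,
      R₀ ≤ Real.sqrt (∑ j, ((x j : ℝ)) ^ 2) →
      Real.sqrt (∑ j, (((x - y) j : ℝ)) ^ 2) ≤ δ * Real.sqrt (∑ j, ((x j : ℝ)) ^ 2) →
        |a x * Real.sqrt (∑ j, ((x j : ℝ)) ^ 2) ^ (5 - η)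
          - a y * Real.sqrt (∑ j, ((y j : ℝ)) ^ 2) ^ (5 - η)| ≤ ε := by
  have hp'0 : (0 : ℝ) ≤ 5 - η := by linarith
  have hp'5 : 5 - η ≤ (5 : ℝ) := by linarith
  intro ε hε
  set L₁ : ℝ := 4 * C₁ + 128 * C₂ with hL₁
  set Ltot : ℝ := 16 * L₁ + 15872 * C₀ + 1 with hLtot
  have hLtot0 : 0 < Ltot := by positivity
  set δ : ℝ := min (1 / 4) (ε / Ltot) with hδ
  have hδ0 : 0 < δ := lt_min (by norm_num) (div_pos hε hLtot0)
  have hδ4 : δ ≤ 1 / 4 := min_le_left _ _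
  have hδε : δ * Ltot ≤ ε := by
    have := min_le_right (1 / 4 : ℝ) (ε / Ltot)
    rwa [le_div_iff₀ hLtot0] at this
  refine ⟨δ, hδ0, Real.sqrt 3 * ((4 * N₁ + 12 : ℕ) : ℝ), fun x y hR hxy => ?_⟩
  have hs3 : (0 : ℝ) ≤ Real.sqrt 3 := Real.sqrt_nonneg 3
  have hs3' : Real.sqrt 3 ≤ 2 := by
    nlinarith [Real.sq_sqrt (show (0 : ℝ) ≤ 3 by norm_num), Real.sqrt_nonneg 3]
  have hs3pos : (0 : ℝ) < Real.sqrt 3 := Real.sqrt_pos.2 (by norm_num)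
  obtain ⟨i, hi⟩ := exists_dominant_coord x
  -- the slab indices `n = |x_i|`, `m = |y_i|`
  have hxi : (((x i).natAbs : ℕ) : ℝ) = |(x i : ℝ)| := by rw [Nat.cast_natAbs, Int.cast_abs]
  have hrn : Real.sqrt (∑ j, ((x j : ℝ)) ^ 2) ≤ Real.sqrt 3 * (x i).natAbs := by
    rw [hxi]; exact euclid_le_sqrt_three_mul x i hi
  have hnbig : 4 * N₁ + 12 ≤ (x i).natAbs := by
    have h1 := le_trans hR hrn
    have h2 : ((4 * N₁ + 12 : ℕ) : ℝ) ≤ (x i).natAbs := le_of_mul_le_mul_left h1 hs3pos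
    exact_mod_cast h2
  have hn0 : (0 : ℝ) < (x i).natAbs := by exact_mod_cast (show 0 < (x i).natAbs by omega)
  have hr0 : 0 ≤ Real.sqrt (∑ j, ((x j : ℝ)) ^ 2) := Real.sqrt_nonneg _
  have hnm : |(((x i).natAbs : ℕ) : ℝ) - ((y i).natAbs : ℕ)| ≤ δ * Real.sqrt 3 * (x i).natAbs := by
    calc |(((x i).natAbs : ℕ) : ℝ) - ((y i).natAbs : ℕ)| ≤ Real.sqrt (∑ j, (((x - y) j : ℝ)) ^ 2) :=
          abs_natAbs_sub_natAbs_le x y i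
      _ ≤ δ * Real.sqrt (∑ j, ((x j : ℝ)) ^ 2) := hxy
      _ ≤ δ * (Real.sqrt 3 * (x i).natAbs) := mul_le_mul_of_nonneg_left hrn hδ0.le
      _ = δ * Real.sqrt 3 * (x i).natAbs := by ring
  have h2m : (x i).natAbs ≤ 2 * (y i).natAbs := by
    have h := (abs_le.mp hnm).2
    have h' : δ * Real.sqrt 3 * (x i).natAbs ≤ (1 / 2) * (x i).natAbs := by
      have : δ * Real.sqrt 3 ≤ 1 / 2 := by nlinarith
      exact mul_le_mul_of_nonneg_right this hn0.le
    have : (((x i).natAbs : ℕ) : ℝ) ≤ 2 * ((y i).natAbs : ℕ) := by linarith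
    exact_mod_cast this
  have hmN : 2 * N₁ + 2 ≤ (y i).natAbs := by omega
  have hm0 : (0 : ℝ) < (y i).natAbs := by exact_mod_cast (show 0 < (y i).natAbs by omega)
  -- slab representations of `a x` and `a y`
  have hax := slab_profile_natAbs hflip x i
  have hay := slab_profile_natAbs hflip y i
  have hnp0 : 0 < (((x i).natAbs : ℕ) : ℝ) ^ (5 - η) := Real.rpow_pos_of_pos hn0 _
  have hnq : (((x i).natAbs : ℕ) : ℝ) ^ (6 - η) = (((x i).natAbs : ℕ) : ℝ) ^ (5 - η) * (x i).natAbs := by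
    rw [show (6 : ℝ) - η = (5 - η) + 1 by ring, Real.rpow_add hn0, Real.rpow_one]
  -- transverse step at level `n`
  have hT1 : |a (Fin.insertNth i (((x i).natAbs : ℕ) : ℤ) (Fin.removeNth i x)) -
      a (Fin.insertNth i (((x i).natAbs : ℕ) : ℤ) (Fin.removeNth i y))| *
        (((x i).natAbs : ℕ) : ℝ) ^ (5 - η) ≤ 4 * C₁ * δ := by
    have h := hR1 i (x i).natAbs (by omega) (Fin.removeNth i x) (Fin.removeNth i y)
    have hD : ∑ j : Fin 2, |((Fin.removeNth i x j : ℤ) : ℝ) - (Fin.removeNth i y j : ℤ)|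
        ≤ 4 * δ * (x i).natAbs := by
      calc _ ≤ 2 * Real.sqrt (∑ j, (((x - y) j : ℝ)) ^ 2) := transverse_dist_le x y i
        _ ≤ 2 * (δ * (Real.sqrt 3 * (x i).natAbs)) := by
            linarith [hxy, mul_le_mul_of_nonneg_left hrn hδ0.le]
        _ = (2 * δ * (x i).natAbs) * Real.sqrt 3 := by ring
        _ ≤ (2 * δ * (x i).natAbs) * 2 := mul_le_mul_of_nonneg_left hs3' (by positivity)
        _ = 4 * δ * (x i).natAbs := by ring
    rw [hnq] at h
    have h' := h.trans (mul_le_mul_of_nonneg_left hD hC₁0)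
    refine le_of_mul_le_mul_right ?_ hn0
    calc _ = |a (Fin.insertNth i (((x i).natAbs : ℕ) : ℤ) (Fin.removeNth i x)) -
          a (Fin.insertNth i (((x i).natAbs : ℕ) : ℤ) (Fin.removeNth i y))| *
          ((((x i).natAbs : ℕ) : ℝ) ^ (5 - η) * (x i).natAbs) := by ring
      _ ≤ C₁ * (4 * δ * (x i).natAbs) := h'
      _ = 4 * C₁ * δ * (x i).natAbs := by ring
  -- longitudinal chain from level `n` to level `m`
  have hT2 : |a (Fin.insertNth i (((x i).natAbs : ℕ) : ℤ) (Fin.removeNth i y)) -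
      a (Fin.insertNth i (((y i).natAbs : ℕ) : ℤ) (Fin.removeNth i y))| *
        (((x i).natAbs : ℕ) : ℝ) ^ (5 - η) ≤ 128 * C₂ * δ := by
    have h := abs_sub_le_longitudinal (f := fun j : ℕ => a (Fin.insertNth i (j : ℤ) (Fin.removeNth i y)))
      (q := 6 - η) (by linarith) (N := 2 * N₁ + 4) (C₂ := C₂) (fun j hj => hR2 i j hj _)
      (n := (x i).natAbs) (m := (y i).natAbs) (by omega) h2m
    have h64 : (2 : ℝ) ^ (6 - η) ≤ 64 := by
      calc (2 : ℝ) ^ (6 - η) ≤ 2 ^ (6 : ℝ) := Real.rpow_le_rpow_of_exponent_le (by norm_num) (by linarith)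
        _ = 64 := by norm_num
    have hnm' : |(((x i).natAbs : ℕ) : ℝ) - ((y i).natAbs : ℕ)| ≤ 2 * δ * (x i).natAbs := by
      calc _ ≤ δ * Real.sqrt 3 * (x i).natAbs := hnm
        _ = (δ * (x i).natAbs) * Real.sqrt 3 := by ring
        _ ≤ (δ * (x i).natAbs) * 2 := mul_le_mul_of_nonneg_left hs3' (by positivity)
        _ = 2 * δ * (x i).natAbs := by ring
    calc _ ≤ |(((x i).natAbs : ℕ) : ℝ) - ((y i).natAbs : ℕ)| *
          (2 ^ (6 - η) * C₂ / (((x i).natAbs : ℕ) : ℝ) ^ (6 - η)) * (((x i).natAbs : ℕ) : ℝ) ^ (5 - η) :=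
          mul_le_mul_of_nonneg_right h hnp0.le
      _ = |(((x i).natAbs : ℕ) : ℝ) - ((y i).natAbs : ℕ)| * 2 ^ (6 - η) * C₂ / (x i).natAbs := by
          rw [hnq]; field_simp
      _ ≤ (2 * δ * (x i).natAbs) * 64 * C₂ / (x i).natAbs := by gcongr
      _ = 128 * C₂ * δ := by field_simp; ring
  -- hence `|a x − a y| n^{5-η} ≤ L₁ δ`
  have hDiff : |a x - a y| * (((x i).natAbs : ℕ) : ℝ) ^ (5 - η) ≤ L₁ * δ := by
    rw [← hax, ← hay]
    refine le_trans (mul_le_mul_of_nonneg_right (abs_sub_le _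
      (a (Fin.insertNth i (((x i).natAbs : ℕ) : ℤ) (Fin.removeNth i y))) _) hnp0.le) ?_
    rw [add_mul]
    exact (add_le_add hT1 hT2).trans (le_of_eq (by ring))
  -- `a y n^{5-η} ≤ 32 C₀`
  have hay0 : 0 ≤ a y := by rw [← hay]; exact hnn i _ (by omega) _
  have hayC : a y * (((x i).natAbs : ℕ) : ℝ) ^ (5 - η) ≤ 32 * C₀ := by
    have h := hR0 i (y i).natAbs hmN (Fin.removeNth i y)
    rw [hay, abs_of_nonneg hay0] at h
    have h32 : (2 : ℝ) ^ (5 - η) ≤ 32 := by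
      calc (2 : ℝ) ^ (5 - η) ≤ 2 ^ (5 : ℝ) := Real.rpow_le_rpow_of_exponent_le (by norm_num) hp'5
        _ = 32 := by norm_num
    have hnm2 : (((x i).natAbs : ℕ) : ℝ) ^ (5 - η) ≤ 32 * (((y i).natAbs : ℕ) : ℝ) ^ (5 - η) := by
      calc (((x i).natAbs : ℕ) : ℝ) ^ (5 - η) ≤ (2 * (((y i).natAbs : ℕ) : ℝ)) ^ (5 - η) :=
            Real.rpow_le_rpow hn0.le (by exact_mod_cast h2m) hp'0
        _ = 2 ^ (5 - η) * (((y i).natAbs : ℕ) : ℝ) ^ (5 - η) := Real.mul_rpow (by norm_num) hm0.le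
        _ ≤ 32 * (((y i).natAbs : ℕ) : ℝ) ^ (5 - η) :=
            mul_le_mul_of_nonneg_right h32 (Real.rpow_nonneg hm0.le _)
    calc a y * (((x i).natAbs : ℕ) : ℝ) ^ (5 - η) ≤ a y * (32 * (((y i).natAbs : ℕ) : ℝ) ^ (5 - η)) :=
          mul_le_mul_of_nonneg_left hnm2 hay0
      _ = 32 * (a y * (((y i).natAbs : ℕ) : ℝ) ^ (5 - η)) := by ring
      _ ≤ 32 * C₀ := by linarith
  -- powers of the two comparable lengths
  have hrs : |Real.sqrt (∑ j, ((x j : ℝ)) ^ 2) - Real.sqrt (∑ j, ((y j : ℝ)) ^ 2)|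
      ≤ δ * Real.sqrt (∑ j, ((x j : ℝ)) ^ 2) := (abs_euclid_sub_euclid_le x y).trans hxy
  have hpow := abs_rpow_sub_rpow_le hr0 (Real.sqrt_nonneg _) hδ0.le (by linarith) hp'0 hp'5 hrs
  have hfin := equicont_arith hδ0.le hn0 hp'0 hp'5 hr0 hrn hay0 hDiff hayC hpow
  calc _ ≤ (16 * L₁ + 15872 * C₀) * δ := hfin
    _ ≤ Ltot * δ := by gcongr; linarith
    _ = δ * Ltot := mul_comm _ _
    _ ≤ ε := hδε

/-! ### (R3) slab tightness -/

/-- **(R3)** from the axial rate and the radial lower bound: slab tightness. -/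
theorem regular_tight {a : (Fin 3 → ℤ) → ℝ} {η c : ℝ} {N₁ : ℕ} {C₀ : ℝ}
    (hflip : ∀ (j : Fin 3) (x : Fin 3 → ℤ), a (Function.update x j (-x j)) = a x)
    (hη0 : 0 < η) (hη1 : η < 1) (hc : 0 < c)
    (hnn : ∀ (i : Fin 3) (n : ℕ), 1 ≤ n → ∀ y : Fin 2 → ℤ, 0 ≤ a (Fin.insertNth i (n : ℤ) y))
    (hlow : ∀ (i : Fin 3) (n : ℕ), N₁ ≤ n →
      c / 2 ≤ (∑' y : Fin 2 → ℤ, a (Fin.insertNth i (n : ℤ) y)) * (n : ℝ) ^ (3 - η))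
    (hR0 : ∀ (i : Fin 3) (n : ℕ), 2 * N₁ + 2 ≤ n → ∀ y : Fin 2 → ℤ,
      |a (Fin.insertNth i (n : ℤ) y)| * (n : ℝ) ^ (5 - η) ≤ C₀) :
    ∀ ε : ℝ, 0 < ε → ∃ K : ℝ, 0 < K ∧ ∃ N₀ : ℕ, ∀ (i : Fin 3) (n : ℕ), N₀ ≤ n →
      (∑' y : Fin 2 → ℤ, if K * (n : ℝ) < ‖y‖ then a (Fin.insertNth i (n : ℤ) y) else 0)
        ≤ ε * (∑' y : Fin 2 → ℤ, a (Fin.insertNth i (n : ℤ) y)) := by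
  intro ε hε
  set C₀' : ℝ := max C₀ 1 with hC₀'
  have hC₀'1 : 1 ≤ C₀' := le_max_right _ _
  have hC₀'0 : 0 < C₀' := by linarith
  have h3η : 0 < 3 - η := by linarith
  set K : ℝ := max 2 (128 * C₀' / ((3 - η) * ε * c)) with hK
  have hK2 : 2 ≤ K := le_max_left _ _
  refine ⟨K, by linarith, 2 * N₁ + 2, fun i n hn => ?_⟩
  have hn1 : 1 ≤ n := by omega
  have hn1' : (1 : ℝ) ≤ n := by exact_mod_cast hn1
  have hnN : ((2 * N₁ + 2 : ℕ) : ℝ) ≤ n := by exact_mod_cast hn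
  have hKn0 : 0 ≤ K * n := by positivity
  set F : (Fin 2 → ℤ) → ℝ := fun y => if K * (n : ℝ) < ‖y‖ then a (Fin.insertNth i (n : ℤ) y) else 0
    with hF
  set g : ℕ → ℝ := fun m => if K * (n : ℝ) < m then C₀' / (m : ℝ) ^ (5 - η) else 0 with hg
  have hF0 : ∀ y, 0 ≤ F y := fun y => by
    simp only [hF]
    split_ifs
    · exact hnn i n hn1 y
    · exact le_rfl
  -- the shell bound: on `‖y‖∞ = m`, `F y ≤ g m`
  have hFg : ∀ (y : Fin 2 → ℤ) (m : ℕ), (∀ j, (y j).natAbs ≤ m) → (∃ j, (y j).natAbs = m) →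
      F y ≤ g m := by
    intro y m h1 h2
    obtain ⟨j₀, hnorm, hdom⟩ := norm_eq_natAbs y
    have hm : (y j₀).natAbs = m := by
      obtain ⟨j, hj⟩ := h2
      exact le_antisymm (h1 j₀) (hj ▸ hdom j)
    rw [hm] at hnorm
    simp only [hF, hg, hnorm]
    by_cases hKm : K * (n : ℝ) < (m : ℝ)
    · rw [if_pos hKm, if_pos hKm]
      have hxl : ((Fin.insertNth i (n : ℤ) y : Fin 3 → ℤ) (i.succAbove j₀)).natAbs = m := by
        rw [Fin.insertNth_apply_succAbove, hm]
      have hrepr := slab_profile_natAbs hflip (Fin.insertNth i (n : ℤ) y) (i.succAbove j₀)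
      rw [hxl] at hrepr
      have hmN : 2 * N₁ + 2 ≤ m := by
        have : ((2 * N₁ + 2 : ℕ) : ℝ) ≤ m := by nlinarith
        exact_mod_cast this
      have hrate := hR0 (i.succAbove j₀) m hmN
        (Fin.removeNth (i.succAbove j₀) (Fin.insertNth i (n : ℤ) y : Fin 3 → ℤ))
      rw [hrepr] at hrate
      have hm0 : (0 : ℝ) < m := by exact_mod_cast (show 0 < m by omega)
      rw [le_div_iff₀ (Real.rpow_pos_of_pos hm0 _)]
      calc a (Fin.insertNth i (n : ℤ) y) * (m : ℝ) ^ (5 - η)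
          ≤ |a (Fin.insertNth i (n : ℤ) y)| * (m : ℝ) ^ (5 - η) :=
            mul_le_mul_of_nonneg_right (le_abs_self _) (Real.rpow_nonneg hm0.le _)
        _ ≤ C₀ := hrate
        _ ≤ C₀' := le_max_left _ _
    · rw [if_neg hKm, if_neg hKm]
  have hF00 : F 0 = 0 := by
    simp only [hF, norm_zero]
    rw [if_neg (not_lt.mpr hKn0)]
  -- the tail sum over the shells
  set M : ℕ := ⌊K * n⌋₊ with hM
  have hM1 : 1 ≤ M := Nat.le_floor (by push_cast; nlinarith)
  have hKM : max 2 (128 * C₀' / ((3 - η) * ε * c)) * n < M + 1 := Nat.lt_floor_add_one _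
  set G : ℕ → ℝ := fun m => ((m : ℝ) + 1) * g (m + 1) / C₀' with hG
  have hG1 : ∀ m, M ≤ m → G m ≤ (((m : ℝ) + 1) ^ (4 - η))⁻¹ := by
    intro m hMm
    have hlt : K * n < (m : ℝ) + 1 := by
      have := (Nat.floor_lt hKn0).mp (Nat.lt_succ_of_le hMm)
      push_cast at this
      exact this
    have hm1 : (0 : ℝ) < (m : ℝ) + 1 := by positivity
    simp only [hG, hg]
    push_cast
    rw [if_pos hlt, show (5 : ℝ) - η = (4 - η) + 1 by ring, Real.rpow_add hm1, Real.rpow_one]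
    rw [div_le_iff₀ hC₀'0]
    field_simp
    exact le_rfl
  have hG2 : ∀ m, m < M → G m ≤ 0 := by
    intro m hmM
    have hle : (m : ℝ) + 1 ≤ K * n := by
      have h1 : ((m + 1 : ℕ) : ℝ) ≤ (M : ℝ) := by exact_mod_cast hmM
      have := h1.trans (Nat.floor_le hKn0)
      push_cast at this
      exact this
    simp only [hG, hg]
    push_cast
    rw [if_neg (not_lt.mpr hle)]
    simp
  have htail := sum_range_le_of_tail (q := 4 - η) (by linarith) hM1 G hG1 hG2
  have hB0 : 0 ≤ 8 * C₀' * ((((M : ℝ) ^ (3 - η))⁻¹) / (3 - η)) :=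
    mul_nonneg (by positivity) (div_nonneg (inv_nonneg.2 (Real.rpow_nonneg (Nat.cast_nonneg M) _)) h3η.le)
  have hbox : ∀ L : ℕ, ∑ y ∈ Fintype.piFinset (fun _ : Fin 2 => Finset.Icc (-(L : ℤ)) L), F y
      ≤ 8 * C₀' * ((((M : ℝ) ^ (3 - η))⁻¹) / (3 - η)) := by
    intro L
    refine (sum_box_le_shells F g hFg L).trans ?_
    rw [hF00, zero_add]
    have hsumG : ∑ m ∈ Finset.range L, 8 * ((m : ℝ) + 1) * g (m + 1)
        = 8 * C₀' * ∑ m ∈ Finset.range L, G m := by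
      rw [Finset.mul_sum]
      refine Finset.sum_congr rfl fun m _ => ?_
      simp only [hG]
      field_simp
    rw [hsumG]
    have h := htail L
    rw [show (4 : ℝ) - η - 1 = 3 - η by ring] at h
    exact mul_le_mul_of_nonneg_left h (by positivity)
  have hT : (∑' y, F y) ≤ 8 * C₀' * ((((M : ℝ) ^ (3 - η))⁻¹) / (3 - η)) :=
    tsum_le_of_sum_box_le hF0 hB0 hbox
  exact tightness_arith hη0.le hη1 hC₀'0.le hc hε hn1' hKM hT (hlow i n (by omega))

/-! ### Registered helper sub-goal -/

/-- **Registered helper sub-goal `stub_scaleRegularity_auxBounded`** of stub `stub_scaleRegularity`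
(line `self-energy-pick-inversion`, crux stmt-CriticalPhenomena-4799): clause (R1) from the axial rate —
if a sign-flip invariant `a : ℤ³ → ℝ`, nonnegative off the origin, has slab profiles with
`|a(insertNth i n y)| n^{5-η} ≤ C₀` for `n ≥ 2N₁ + 2`, then `a(x)|x|₂^{5-η}` is bounded. -/
theorem stub_scaleRegularity_auxBounded :
    ∀ (a : (Fin 3 → ℤ) → ℝ) (η C₀ : ℝ) (N₁ : ℕ), (∀ x : Fin 3 → ℤ, x ≠ 0 → 0 ≤ a x) →
    (∀ (j : Fin 3) (x : Fin 3 → ℤ), a (Function.update x j (-x j)) = a x) → 0 < η → η < 1 →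
    (∀ (i : Fin 3) (n : ℕ), 2 * N₁ + 2 ≤ n → ∀ y : Fin 2 → ℤ,
      |a (Fin.insertNth i (n : ℤ) y)| * (n : ℝ) ^ (5 - η) ≤ C₀) →
    ∃ C : ℝ, ∀ x : Fin 3 → ℤ, x ≠ 0 → a x * Real.sqrt (∑ j, ((x j : ℝ)) ^ 2) ^ (5 - η) ≤ C :=
  fun _a _η _C₀ _N₁ hpos hflip hη0 hη1 hR0 => regular_bounded hpos hflip hη0 hη1 hR0

end Summit.CriticalPhenomena.Ising3DConformalLimit.Cruxes.DirectCorrelationStableTail.SelfEnergyPickInversion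

end
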